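import Summits.Ventures.PercRepro.C041RcPortCount

/-!
# THEOREM R, the rc reduction: the recolouring of the terminal edges at the port vertices (p6, gen 24)

Setting of `C041RcPortCount`.  `rcRecolour x′ S` gives the terminal edges at the port vertices the colours `x′` and
keeps every other edge of `S`.  Its pattern is `x′` (`rcPattern_rcRecolour`); recolouring by the own pattern is the
identity (`rcRecolour_self`); recolourings compose (`rcRecolour_rcRecolour`); and the outside conditions, which read
only the edges that are not terminal edges at port vertices — bare edges (`not_termEdge_of_bare`), edges between
the terminals (`not_termEdge_of_joins_ab`), terminal edges at vertices outside `K` (`not_termEdge_of_not_mem`) — are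
unchanged (`outside_rcRecolour`).  With `rcSrc_iff` this makes `S ↦ rcRecolour x′ S` a bijection between the fibres
of two admissible valid patterns (`C041RcPortCountSum`).
-/

namespace PercRepro

namespace MultiGraph

open Finset ZonePort

variable {V E : Type*} {G : MultiGraph V E}

/-- The ends of an edge, read off two `Joins` descriptions. -/
theorem rc_joins_ends {e : E} {u v u' v' : V} (h : G.Joins e u v) (h' : G.Joins e u' v') :
    (u = u' ∧ v = v') ∨ (u = v' ∧ v = u') := by
  rcases h with ⟨h1, h2⟩ | ⟨h1, h2⟩ <;> rcases h' with ⟨h3, h4⟩ | ⟨h3, h4⟩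
  · exact Or.inl ⟨h1.symm.trans h3, h2.symm.trans h4⟩
  · exact Or.inr ⟨h1.symm.trans h3, h2.symm.trans h4⟩
  · exact Or.inr ⟨h2.symm.trans h4, h1.symm.trans h3⟩
  · exact Or.inl ⟨h2.symm.trans h4, h1.symm.trans h3⟩

section Recolour

variable [Fintype V] {a b c : V} (hca : c ≠ a) (hcb : c ≠ b)
  (hc : ∀ e, ¬ G.Joins e c a ∧ ¬ G.Joins e c b) (hne : a ≠ b) (O : Config E)

omit [Fintype V] in
/-- A bare edge is not a terminal edge at a port vertex. -/
theorem not_termEdge_of_bare {e : E} (he : G.Bare a b e) : ¬ G.TermEdge a b c O e := by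
  rintro ⟨v, _, h | h⟩
  · exact he.1 (EdgeAt.of_joins_right h)
  · exact he.2 (EdgeAt.of_joins_right h)

omit [Fintype V] in
include hca hcb in
/-- An edge between the terminals is not a terminal edge at a port vertex. -/
theorem not_termEdge_of_joins_ab {e : E} (he : G.Joins e a b) : ¬ G.TermEdge a b c O e := by
  rintro ⟨v, hv, h | h⟩
  · have hvt := portVert_ne_terminal a b c O hca hcb hv
    rcases rc_joins_ends h he with ⟨h1, _⟩ | ⟨h1, _⟩
    · exact hvt.1 h1
    · exact hvt.2 h1
  · have hvt := portVert_ne_terminal a b c O hca hcb hv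
    rcases rc_joins_ends h he.symm with ⟨h1, _⟩ | ⟨h1, _⟩
    · exact hvt.2 h1
    · exact hvt.1 h1

omit [Fintype V] in
include hca hcb hne in
/-- A terminal edge at a vertex outside `K` is not a terminal edge at a port vertex. -/
theorem not_termEdge_of_not_mem {u : V} (hu : u ∉ G.BareReach a b c O) {e : E}
    (he : G.Joins e u a ∨ G.Joins e u b) : ¬ G.TermEdge a b c O e := by
  rintro ⟨v, hv, h⟩
  have hvt := portVert_ne_terminal a b c O hca hcb hv
  rcases he with he | he <;> rcases h with h | h
  · rcases rc_joins_ends h he with ⟨h1, _⟩ | ⟨h1, _⟩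
    · exact hu (h1 ▸ hv.1)
    · exact hvt.1 h1
  · rcases rc_joins_ends h he with ⟨h1, h2⟩ | ⟨h1, _⟩
    · exact hne (h2.symm)
    · exact hvt.1 h1
  · rcases rc_joins_ends h he with ⟨h1, h2⟩ | ⟨h1, _⟩
    · exact hne h2
    · exact hvt.2 h1
  · rcases rc_joins_ends h he with ⟨h1, _⟩ | ⟨h1, _⟩
    · exact hu (h1 ▸ hv.1)
    · exact hvt.2 h1

open Classical in
/-- **The recolouring**: the terminal edges at the port vertices take the colours `x′`, every other edge keeps its
colour. -/
noncomputable def rcRecolour (x' : (G.rcPort a b c O hca hcb hc).Term → Bool) (S : Config E) : Config E :=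
  fun e => if h : G.TermEdge a b c O e then x' (toTerm hca hcb hc ⟨e, h⟩) else S e

variable {O}

/-- The recolouring at a terminal edge of a port vertex. -/
theorem rcRecolour_of_term (x' : (G.rcPort a b c O hca hcb hc).Term → Bool) (S : Config E) (e : G.TE a b c O) :
    rcRecolour hca hcb hc O x' S e.1 = x' (toTerm hca hcb hc e) := by
  unfold rcRecolour
  rw [dif_pos e.2]

/-- The recolouring elsewhere. -/
theorem rcRecolour_of_not_term (x' : (G.rcPort a b c O hca hcb hc).Term → Bool) (S : Config E) {e : E}
    (he : ¬ G.TermEdge a b c O e) : rcRecolour hca hcb hc O x' S e = S e := by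
  unfold rcRecolour
  rw [dif_neg he]

/-- **The pattern of a recoloured configuration is `x′`.** -/
theorem rcPattern_rcRecolour (x' : (G.rcPort a b c O hca hcb hc).Term → Bool) (S : Config E) :
    rcPattern hca hcb hc (rcRecolour hca hcb hc O x' S) = x' := by
  funext t
  show rcRecolour hca hcb hc O x' S t.1.1 = x' t
  rw [rcRecolour_of_term]
  rfl

/-- **Recolouring by the own pattern is the identity.** -/
theorem rcRecolour_self (S : Config E) : rcRecolour hca hcb hc O (rcPattern hca hcb hc S) S = S := by
  funext e
  by_cases he : G.TermEdge a b c O e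
  · rw [rcRecolour_of_term hca hcb hc _ S ⟨e, he⟩]
    rfl
  · exact rcRecolour_of_not_term hca hcb hc _ S he

/-- **Recolourings compose.** -/
theorem rcRecolour_rcRecolour (x x' : (G.rcPort a b c O hca hcb hc).Term → Bool) (S : Config E) :
    rcRecolour hca hcb hc O x (rcRecolour hca hcb hc O x' S) = rcRecolour hca hcb hc O x S := by
  funext e
  by_cases he : G.TermEdge a b c O e
  · rw [rcRecolour_of_term hca hcb hc _ _ ⟨e, he⟩, rcRecolour_of_term hca hcb hc _ _ ⟨e, he⟩]
  · rw [rcRecolour_of_not_term hca hcb hc _ _ he, rcRecolour_of_not_term hca hcb hc _ _ he,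
      rcRecolour_of_not_term hca hcb hc _ _ he]

include hne in
/-- A blue edge to `a` at a vertex outside `K` is unchanged by the recolouring. -/
theorem blueA_rcRecolour (x' : (G.rcPort a b c O hca hcb hc).Term → Bool) (S : Config E) {u : V}
    (hu : u ∉ G.BareReach a b c O) :
    G.BlueTo a (rcRecolour hca hcb hc O x' S) u ↔ G.BlueTo a S u := by
  constructor
  · rintro ⟨e, hj, hS⟩
    refine ⟨e, hj, ?_⟩
    rw [rcRecolour_of_not_term hca hcb hc _ _ (not_termEdge_of_not_mem hca hcb hne O hu (Or.inl hj))] at hS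
    exact hS
  · rintro ⟨e, hj, hS⟩
    refine ⟨e, hj, ?_⟩
    rw [rcRecolour_of_not_term hca hcb hc _ _ (not_termEdge_of_not_mem hca hcb hne O hu (Or.inl hj))]
    exact hS

include hne in
/-- A blue edge to `b` at a vertex outside `K` is unchanged by the recolouring. -/
theorem blueB_rcRecolour (x' : (G.rcPort a b c O hca hcb hc).Term → Bool) (S : Config E) {u : V}
    (hu : u ∉ G.BareReach a b c O) :
    G.BlueTo b (rcRecolour hca hcb hc O x' S) u ↔ G.BlueTo b S u := by
  constructor
  · rintro ⟨e, hj, hS⟩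
    refine ⟨e, hj, ?_⟩
    rw [rcRecolour_of_not_term hca hcb hc _ _ (not_termEdge_of_not_mem hca hcb hne O hu (Or.inr hj))] at hS
    exact hS
  · rintro ⟨e, hj, hS⟩
    refine ⟨e, hj, ?_⟩
    rw [rcRecolour_of_not_term hca hcb hc _ _ (not_termEdge_of_not_mem hca hcb hne O hu (Or.inr hj))]
    exact hS

include hne in
/-- **The outside conditions are unchanged by the recolouring.** -/
theorem outside_rcRecolour (x' : (G.rcPort a b c O hca hcb hc).Term → Bool) (S : Config E) :
    G.RcOutside a b c O (rcRecolour hca hcb hc O x' S) ↔ G.RcOutside a b c O S := by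
  have hbare : ∀ e, G.Bare a b e → rcRecolour hca hcb hc O x' S e = S e :=
    fun e he => rcRecolour_of_not_term hca hcb hc _ _ (not_termEdge_of_bare O he)
  have hab : ∀ e, G.Joins e a b → rcRecolour hca hcb hc O x' S e = S e :=
    fun e he => rcRecolour_of_not_term hca hcb hc _ _ (not_termEdge_of_joins_ab hca hcb O he)
  unfold RcOutside
  constructor
  · rintro ⟨h1, h2, h3, h4⟩
    refine ⟨fun e he => ?_, fun e he => ?_, fun u hu hb => ?_, fun u u' hu hu' huu' hb => ?_⟩
    · rw [← hbare e he]
      exact h1 e he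
    · rw [← hab e he]
      exact h2 e he
    · refine h3 u hu ?_
      rw [blueA_rcRecolour hca hcb hc hne x' S hu, blueB_rcRecolour hca hcb hc hne x' S hu]
      exact hb
    · refine h4 u u' hu hu' huu' ?_
      rw [blueA_rcRecolour hca hcb hc hne x' S hu, blueB_rcRecolour hca hcb hc hne x' S hu']
      exact hb
  · rintro ⟨h1, h2, h3, h4⟩
    refine ⟨fun e he => ?_, fun e he => ?_, fun u hu hb => ?_, fun u u' hu hu' huu' hb => ?_⟩
    · rw [hbare e he]
      exact h1 e he
    · rw [hab e he]
      exact h2 e he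
    · refine h3 u hu ?_
      rw [blueA_rcRecolour hca hcb hc hne x' S hu, blueB_rcRecolour hca hcb hc hne x' S hu] at hb
      exact hb
    · refine h4 u u' hu hu' huu' ?_
      rw [blueA_rcRecolour hca hcb hc hne x' S hu, blueB_rcRecolour hca hcb hc hne x' S hu'] at hb
      exact hb

include hne in
/-- **Recolouring a source by an admissible valid pattern gives a source.** -/
theorem rcSrc_rcRecolour (habE : ∃ e, G.Joins e a b) {S : Config E} (hS : G.IsRcSrc a b c O S)
    {x' : (G.rcPort a b c O hca hcb hc).Term → Bool} (hadm : (G.rcPort a b c O hca hcb hc).Adm x')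
    (hval : (G.rcPort a b c O hca hcb hc).X₁ x' ∨ (G.rcPort a b c O hca hcb hc).X₂ x') :
    G.IsRcSrc a b c O (rcRecolour hca hcb hc O x' S) := by
  rw [rcSrc_iff hca hcb hc hne habE, rcPattern_rcRecolour, outside_rcRecolour hca hcb hc hne]
  exact ⟨⟨hadm, hval⟩, ((rcSrc_iff hca hcb hc hne habE).1 hS).2⟩

end Recolour

end MultiGraph

end PercRepro
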